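import Literature.IUT.LogThetaLattice.PacketLogVolumes
import Literature.IUT.LogVolume.PacketVolume

/-!
# [IUTchIII] Proposition 3.9 (i): the typer's procession-normalization IS campaign-S's procession
# average (named identification for the Cor. 3.12 crew)

S. Mochizuki, *Inter-universal Teichmüller theory III*, kurims manuscript (May 2020), §3, Proposition
3.9 (i), kurims p. 116 ("we normalize by taking the average, over the various capsules"). Companion of
`PacketLogVolumeBridge.lean`: `Literature.IUT.LogThetaLattice.processionNormalized` (p404053, average
over `j ∈ {1, …, l^⋇} = Fin lstar`) equals `Literature.IUT.LogVolume.processionAverage` (abc-iut-S2,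
`PacketVolume.lean`) on the index type `Fin lstar` — PROVED (`Fintype.card_fin`). No new definitions.
Tag form [claim: Mochizuki2012, status: disputed].
-/

namespace Literature.IUT.LogThetaLattice

/-- **[IUTchIII] Prop. 3.9 (i), p. 116 — identification of the two formalisations of the
procession-normalization**: the typer's `processionNormalized` (average over `j ∈ {1, …, l^⋇}` = `Fin
lstar`) IS campaign-S's `processionAverage` over the index type `Fin lstar` — PROVED.
[claim: Mochizuki2012, status: disputed] -/
theorem processionNormalized_eq_processionAverage {lstar : ℕ} (vol : Fin lstar → ℝ) :
    processionNormalized vol = LogVolume.processionAverage vol := by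
  unfold processionNormalized LogVolume.processionAverage
  rw [Fintype.card_fin]

end Literature.IUT.LogThetaLattice
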